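/-
Copyright (c) 2026 the pub-hodgecm-mathlib formalisation cell (harness21).  Prover seat hodgecm-mathlib-F0P2-p02 (g9), ROAD W brick (W5), 2026-09-01.
-/
import Literature.Combinatorics.SimpleGraph.TreeActionAxisPerPeriod   -- parts 1–2 (F0P2-p02 g9): `natCard_quotient_fixed_vertices_add_edges_eq_darts_of_exists` (tree side)
import Mathlib.Algebra.Order.Group.End                                -- `Group (G ≃g G)` (`RelIso`), `RelIso.mul_apply`
import Mathlib.Algebra.Order.Group.Action.End                         -- `RelIso.applyMulAction`
import Mathlib.GroupTheory.GroupAction.Quotient                       -- `MulAction.ofQuotientStabilizer`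
import HarnessLib

/-!
# Kottwitz's NON-ELLIPTIC Euler–Poincaré relation per period, for a group acting on a tree with one orbit of vertices and one orbit of darts (inversions allowed):
# `#(Fix_γ(Γ⧸K_v)∕τ^ℤ) + #(Fix_γ(Γ⧸K_e)∕τ^ℤ) = #(Fix_γ(Γ⧸I)∕τ^ℤ)` (Kottwitz 1988 §2 Thm. 2; Serre, *Trees* I.6.1, I.6.4, II.1.1–1.3)

Topic `Combinatorics/SimpleGraph`; namespace `Literature.Combinatorics.SimpleGraph.TreeAction`.  THEOREMS ONLY (no definition, no instance, no notation, no named fact,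
no `sorry`); kernel lane.  Cell `pub/hodgecm-mathlib`, F0∕P3a, crux H413 = stmt-HodgeConjecture-24833, line «N6nsGerm», residue `stub_N6nsR2ram : RankOneEulerPoincareNonsplitRamified`,
ROAD W («R2EP-wild», MEMO `F0/P3a/F0P3a-p04/g13/MEMO-R2wild.F0P3a-p04g13.md`), brick (W5) «per-period NON-ELLIPTIC relation», COSET SIDE; seat F0P2-p02 (g9) (B-p14 (g32)
10:23:49Z hands; census `F0/P2/p02/g9/CENSUS-W5-NonEllipticPerPeriod.F0P2p02g9.md`).  The ELLIPTIC twin (relation (E), `… = … + 1`) is ★ B-p14 (g32)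
`TreeActionEulerRelation.natCard_fixedBy_add_eq_natCard_fixedBy_add_one_of_treeAction` (p843694); this file takes ITS BINDERS VERBATIM (`act`, `h01`, `hV`, `hD`, `Kv Ke I`,
`hKv`, `hKe`, `hI`), so one set of (W1c)(W2) heads (B-p08 (g28): the action of `U(Φ₂)(E_w)` on the tree of `SL₂(F_v)` and its two stabilisers by type) serves both.
HONEST LABEL: HC_CM is proved only modulo the printed citations until rung 0 closes; this file is pure orbit counting and asserts nothing printed.

THE MATHEMATICS.  `Γ` acts on a tree `G` by automorphisms (`act : Γ →* (G ≃g G)`), transitively on vertices and on darts; `v₀ ∼ v₁`; `Kv = Stab(v₀)`, `Ke = Stab{v₀, v₁}`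
(set-wise; it contains the inversions of the base edge), `I = Kv ⊓ Ke = Stab(v₀, v₁)`.  `γ, τ ∈ Γ` commute; `τ` moves `v₀` to a neighbour and acts freely on it (a
translation of length one along its axis `τ^ℤ v₀`), and `γ` moves `v₀` ALONG that axis (`act γ v₀ = act τ^k v₀`; `k = 0`: `γ` lies in the compact part of the split torus
through `τ`; `k ≠ 0`: `γ` is hyperbolic).  Orbit–stabiliser WITH VALUES AND EQUIVARIANCE (§1: `gK ↦ g · x₀` is a bijection from the `γ`-fixed cosets onto the `γ`-fixed
points of the orbit of `x₀`, intertwining the left translation by the centraliser of `γ` — Mathlib `MulAction.ofQuotientStabilizer`) turns the three per-period coset counts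
into the per-period counts of fixed vertices, set-wise fixed edges and fixed darts of `act γ` under `τ^ℤ`, and ★ `natCard_quotient_fixed_vertices_add_edges_eq_darts_of_exists`
(parts 1–2) is the identity **`#(Fix_γ(Γ⧸Kv)∕τ^ℤ) + #(Fix_γ(Γ⧸Ke)∕τ^ℤ) = #(Fix_γ(Γ⧸I)∕τ^ℤ)`** — in the currency
`Nat.card (Quotient ((orbitRel (zpowers ⟨τ, _⟩ : Subgroup Z_Γ(γ)) (Γ ⧸ K)).comap (Subtype.val : fixedBy (Γ ⧸ K) γ → Γ ⧸ K)))` of ★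
`classOrbitalIntegral_indicator_complex_eq_mul_natCard_quotient_zpowers` (p843359: `ν(K)⁻¹ Φ(⟦γ⟧, 𝟙_K) = #(Fix_γ(G⧸K)∕τ^ℤ)`) and with EXACTLY the conclusion shape of the
tame, hermitian-tree twin ★ `HermitianLatticeTree.natCard_quotient_fixedBy_add_eq_natCard_quotient_fixedBy_inf` (B-p04 (g35)).  Only the finiteness of the `I`-level
quotient is assumed (it implies the other two).  Symmetric in `Kv ↔ Ke`: which of B-p14's levels `K`, `K♯_D` is the vertex and which the edge stabiliser (the «by type»
dichotomy of (W2) at a ramified place) is invisible here.  In the application `Γ = U(Φ₂)(E_w)`, `G` = the tree of `SL₂(F_v)` (★ `SLTwoTreeAsLatticeTree`, ★ `glVertexAct`),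
`τ = t_{ϖ_E}` for ANY uniformiser `ϖ_E` of `E_w` (acting through `[diag(N ϖ_E, 1)]`, a translation of length `ord_F N ϖ_E = 1`), `γ = t_x`, `k = ord x`.

* §1 `exists_fixedBy_quotient_dictionary` (orbit–stabiliser with values and equivariance), `natCard_quotient_orbitRel_fixedBy_eq_of_dictionary` (per-period transfer).
* §2 **`natCard_quotient_fixedBy_add_eq_natCard_quotient_fixedBy_of_treeAction`** (the head) and its twin **`…_of_vertexAction`** for an action given on vertices
  (`act g : V → V`, `act 1 = id`, `act (gh) = act g ∘ act h`, adjacency-preserving — the shape of ★ `glVertexAct` ∕ B-p08's `rhoVertexAct`).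

## References
* [Kottwitz1988] R. E. Kottwitz, *Tamagawa numbers*, Ann. of Math. 127 (1988), 629–646, §2 Theorem 2 (non-elliptic case).
* [Serre1980Trees] J.-P. Serre, *Trees*, Springer (1980): I.6.1 (fixed cosets and fixed points), I.6.4 Prop. 24–25, II.1.1–1.3 (the tree of `SL₂`; `GL₂` acts through `PGL₂`).
* [Laumon1995] G. Laumon, *Cohomology of Drinfeld Modular Varieties* I (1996), Lemma (5.3.2) (orbital integrals as counts of fixed facets modulo the centraliser).
-/

set_option autoImplicit false

open SimpleGraph MulAction
open scoped Pointwise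

namespace Literature.Combinatorics.SimpleGraph.TreeAction

open Literature.Combinatorics.SimpleGraph Literature.GroupTheory

/-! ## §1 Orbit–stabiliser with values and equivariance; per-period transfer -/

section Dictionary

variable {Γ : Type*} [Group Γ] {X : Type*} [MulAction Γ X]

/-- **ORBIT–STABILISER FOR FIXED COSETS, WITH VALUES AND EQUIVARIANCE.**  If `K = Stab_Γ(x₀)` (as a membership statement) then `gK ↦ g · x₀` is a BIJECTION from
the `γ`-fixed cosets of `Γ ⧸ K` onto the `γ`-fixed points of the orbit `Γ · x₀`, and it intertwines left translation by any `c` with `γ`-fixed image coset (e.g. `c`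
in the centraliser of `γ`) with the action of `c` (Mathlib `MulAction.ofQuotientStabilizer`). [cite: Serre1980Trees, I.6.1] -/
theorem exists_fixedBy_quotient_dictionary (x₀ : X) (K : Subgroup Γ) (hK : ∀ g : Γ, g ∈ K ↔ g • x₀ = x₀) (γ : Γ) :
    ∃ f : ↥(fixedBy (Γ ⧸ K) γ) → ↥{x : X | (∃ g : Γ, g • x₀ = x) ∧ γ • x = x},
      Function.Bijective f ∧
      (∀ (g : Γ) (hg : (QuotientGroup.mk g : Γ ⧸ K) ∈ fixedBy (Γ ⧸ K) γ), ((f ⟨_, hg⟩ : ↥{x : X | (∃ g : Γ, g • x₀ = x) ∧ γ • x = x}) : X) = g • x₀) ∧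
      ∀ (c : Γ) (q : ↥(fixedBy (Γ ⧸ K) γ)) (hc : c • (q : Γ ⧸ K) ∈ fixedBy (Γ ⧸ K) γ),
        ((f ⟨_, hc⟩ : ↥{x : X | (∃ g : Γ, g • x₀ = x) ∧ γ • x = x}) : X) = c • ((f q : ↥{x : X | (∃ g : Γ, g • x₀ = x) ∧ γ • x = x}) : X) := by
  have hKs : K = stabilizer Γ x₀ := Subgroup.ext fun g => by rw [hK, mem_stabilizer_iff]
  subst hKs
  have hF : ∀ q : Γ ⧸ stabilizer Γ x₀, ∃ g : Γ, g • x₀ = ofQuotientStabilizer Γ x₀ q := fun q => by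
    induction q using Quotient.inductionOn with
    | h g => exact ⟨g, rfl⟩
  have hfix : ∀ q : ↥(fixedBy (Γ ⧸ stabilizer Γ x₀) γ), γ • ofQuotientStabilizer Γ x₀ q = ofQuotientStabilizer Γ x₀ q := fun q => by
    rw [← ofQuotientStabilizer_smul, MulAction.mem_fixedBy.1 q.2]
  refine ⟨fun q => ⟨ofQuotientStabilizer Γ x₀ q, hF q, hfix q⟩, ⟨fun q q' hqq' => ?_, fun x => ?_⟩, fun g hg => rfl,
    fun c q hc => ofQuotientStabilizer_smul Γ x₀ c q⟩
  · exact Subtype.ext (injective_ofQuotientStabilizer Γ x₀ (congrArg Subtype.val hqq'))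
  · obtain ⟨⟨g, hg⟩, hγx⟩ := x.2
    have hmem : (QuotientGroup.mk g : Γ ⧸ stabilizer Γ x₀) ∈ fixedBy (Γ ⧸ stabilizer Γ x₀) γ := by
      rw [MulAction.mem_fixedBy]
      apply injective_ofQuotientStabilizer Γ x₀
      rw [ofQuotientStabilizer_smul, ofQuotientStabilizer_mk, hg, hγx]
    exact ⟨⟨_, hmem⟩, Subtype.ext (by rw [← hg]; rfl)⟩

/-- **PER-PERIOD TRANSFER ALONG THE DICTIONARY.**  For `γ, τ ∈ Γ` commuting, the number of `τ^ℤ`-orbits (`τ^ℤ ≤ Z_Γ(γ)`) on the `γ`-fixed cosets of `Γ ⧸ K`,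
`K = Stab(x₀)`, equals the number of `τ^ℤ`-orbits on the `γ`-fixed points of `Γ · x₀`, and one quotient is finite iff the other is. [cite: Serre1980Trees, I.6.1; I.6.4] -/
theorem natCard_quotient_orbitRel_fixedBy_eq_of_dictionary (x₀ : X) (K : Subgroup Γ) (hK : ∀ g : Γ, g ∈ K ↔ g • x₀ = x₀) (γ τ : Γ) (hτ : τ * γ = γ * τ) :
    Nat.card (Quotient ((orbitRel (Subgroup.zpowers (⟨τ, Subgroup.mem_centralizer_singleton_iff.2 hτ⟩ : Subgroup.centralizer ({γ} : Set Γ))) (Γ ⧸ K)).comap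
        (Subtype.val : ↥(fixedBy (Γ ⧸ K) γ) → Γ ⧸ K))) =
      Nat.card (Quotient ((orbitRel (Subgroup.zpowers (⟨τ, Subgroup.mem_centralizer_singleton_iff.2 hτ⟩ : Subgroup.centralizer ({γ} : Set Γ))) X).comap
        (Subtype.val : ↥{x : X | (∃ g : Γ, g • x₀ = x) ∧ γ • x = x} → X))) ∧
    (Finite (Quotient ((orbitRel (Subgroup.zpowers (⟨τ, Subgroup.mem_centralizer_singleton_iff.2 hτ⟩ : Subgroup.centralizer ({γ} : Set Γ))) (Γ ⧸ K)).comap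
        (Subtype.val : ↥(fixedBy (Γ ⧸ K) γ) → Γ ⧸ K))) ↔
      Finite (Quotient ((orbitRel (Subgroup.zpowers (⟨τ, Subgroup.mem_centralizer_singleton_iff.2 hτ⟩ : Subgroup.centralizer ({γ} : Set Γ))) X).comap
        (Subtype.val : ↥{x : X | (∃ g : Γ, g • x₀ = x) ∧ γ • x = x} → X)))) := by
  obtain ⟨f, hf, -, hequi⟩ := exists_fixedBy_quotient_dictionary x₀ K hK γ
  refine natCard_quotient_orbitRel_comap_eq_of_bijective _ _ f hf fun s t => ⟨?_, ?_⟩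
  · rintro ⟨φ, hφ⟩
    have hmem : (((φ : Subgroup.centralizer ({γ} : Set Γ)) : Γ)) • (t : Γ ⧸ K) ∈ fixedBy (Γ ⧸ K) γ := by
      rw [show (((φ : Subgroup.centralizer ({γ} : Set Γ)) : Γ)) • (t : Γ ⧸ K) = (s : Γ ⧸ K) from hφ]; exact s.2
    refine ⟨φ, ?_⟩
    have h1 := hequi ((φ : Subgroup.centralizer ({γ} : Set Γ)) : Γ) t hmem
    have h2 : (⟨_, hmem⟩ : ↥(fixedBy (Γ ⧸ K) γ)) = s := Subtype.ext hφ
    rw [h2] at h1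
    exact h1.symm
  · rintro ⟨φ, hφ⟩
    have hcomm : ((φ : Subgroup.centralizer ({γ} : Set Γ)) : Γ) * γ = γ * ((φ : Subgroup.centralizer ({γ} : Set Γ)) : Γ) :=
      Subgroup.mem_centralizer_singleton_iff.1 (φ : Subgroup.centralizer ({γ} : Set Γ)).2
    have hmem : (((φ : Subgroup.centralizer ({γ} : Set Γ)) : Γ)) • (t : Γ ⧸ K) ∈ fixedBy (Γ ⧸ K) γ := by
      rw [MulAction.mem_fixedBy, smul_smul, ← hcomm, ← smul_smul, MulAction.mem_fixedBy.1 t.2]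
    have h1 := hequi ((φ : Subgroup.centralizer ({γ} : Set Γ)) : Γ) t hmem
    have h2 : f ⟨_, hmem⟩ = f s := Subtype.ext (h1.trans hφ)
    exact ⟨φ, congrArg (fun q : ↥(fixedBy (Γ ⧸ K) γ) => (q : Γ ⧸ K)) (hf.1 h2)⟩

end Dictionary

/-! ## §2 The non-elliptic relation per period -/

section Head

variable {V : Type*} {G : SimpleGraph V} {Γ : Type*} [Group Γ]

/-- **KOTTWITZ'S NON-ELLIPTIC EULER–POINCARÉ RELATION, PER PERIOD, FOR A GROUP ACTING ON A TREE WITH ONE ORBIT OF VERTICES AND ONE ORBIT OF DARTS (INVERSIONS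
ALLOWED).**  `Γ` acts on the tree `G` by automorphisms (`act`), transitively on vertices (`hV`) and on darts (`hD`); `v₀ ∼ v₁`; `Kv = Stab(v₀)`, `Ke = Stab{v₀, v₁}` (set-wise),
`I = Stab(v₀, v₁)` — the binders of ★ `natCard_fixedBy_add_eq_natCard_fixedBy_add_one_of_treeAction` verbatim.  For `γ, τ ∈ Γ` commuting, `τ` translating `v₀` to a
neighbour and acting freely on it, and `γ` moving `v₀` along the axis of `τ` (`act γ v₀ = act (τ ^ k) v₀`), if the `I`-level per-period quotient is finite then
`#(Fix_γ(Γ⧸Kv)∕τ^ℤ) + #(Fix_γ(Γ⧸Ke)∕τ^ℤ) = #(Fix_γ(Γ⧸I)∕τ^ℤ)` (`τ^ℤ ≤ Z_Γ(γ)` acting by left translation).  With ★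
`classOrbitalIntegral_indicator_complex_eq_mul_natCard_quotient_zpowers` (×3) this is `ν(Kv)⁻¹Φ(⟦γ⟧, 𝟙_{Kv}) + ν(Ke)⁻¹Φ(⟦γ⟧, 𝟙_{Ke}) − ν(I)⁻¹Φ(⟦γ⟧, 𝟙_I) = 0`.
[cite: Kottwitz1988, §2 Theorem 2] [cite: Serre1980Trees, I.6.1; I.6.4 Prop. 24–25; II.1.1–1.3] [cite: Laumon1995, Lemma (5.3.2)] -/
theorem natCard_quotient_fixedBy_add_eq_natCard_quotient_fixedBy_of_treeAction (hT : G.IsTree) (act : Γ →* (G ≃g G))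
    {v₀ v₁ : V} (h01 : G.Adj v₀ v₁) (hV : ∀ v : V, ∃ g : Γ, act g v₀ = v)
    (hD : ∀ a b : V, G.Adj a b → ∃ g : Γ, act g v₀ = a ∧ act g v₁ = b)
    (Kv Ke I : Subgroup Γ) (hKv : ∀ g : Γ, g ∈ Kv ↔ act g v₀ = v₀)
    (hKe : ∀ g : Γ, g ∈ Ke ↔ s(act g v₀, act g v₁) = s(v₀, v₁))
    (hI : ∀ g : Γ, g ∈ I ↔ act g v₀ = v₀ ∧ act g v₁ = v₁)
    (γ τ : Γ) (hτ : τ * γ = γ * τ) (hstep : G.Adj v₀ (act τ v₀)) (hfree : ∀ n : ℤ, act (τ ^ n) v₀ = v₀ → n = 0)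
    (hγ : ∃ k : ℤ, act γ v₀ = act (τ ^ k) v₀)
    (hfinI : Finite (Quotient ((orbitRel (Subgroup.zpowers (⟨τ, Subgroup.mem_centralizer_singleton_iff.2 hτ⟩ : Subgroup.centralizer ({γ} : Set Γ))) (Γ ⧸ I)).comap
        (Subtype.val : ↥(fixedBy (Γ ⧸ I) γ) → Γ ⧸ I)))) :
    Nat.card (Quotient ((orbitRel (Subgroup.zpowers (⟨τ, Subgroup.mem_centralizer_singleton_iff.2 hτ⟩ : Subgroup.centralizer ({γ} : Set Γ))) (Γ ⧸ Kv)).comap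
        (Subtype.val : ↥(fixedBy (Γ ⧸ Kv) γ) → Γ ⧸ Kv))) +
        Nat.card (Quotient ((orbitRel (Subgroup.zpowers (⟨τ, Subgroup.mem_centralizer_singleton_iff.2 hτ⟩ : Subgroup.centralizer ({γ} : Set Γ))) (Γ ⧸ Ke)).comap
        (Subtype.val : ↥(fixedBy (Γ ⧸ Ke) γ) → Γ ⧸ Ke))) =
      Nat.card (Quotient ((orbitRel (Subgroup.zpowers (⟨τ, Subgroup.mem_centralizer_singleton_iff.2 hτ⟩ : Subgroup.centralizer ({γ} : Set Γ))) (Γ ⧸ I)).comap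
        (Subtype.val : ↥(fixedBy (Γ ⧸ I) γ) → Γ ⧸ I))) := by
  classical
  letI : MulAction Γ V := MulAction.compHom V act
  have hsmul : ∀ (g : Γ) (v : V), g • v = act g v := fun _ _ => rfl
  have hmul : ∀ (a b : Γ) (x : V), act (a * b) x = act a (act b x) := fun a b x => by rw [map_mul, RelIso.mul_apply]
  -- the period group `Φ = τ^ℤ ≤ Z_Γ(γ)` and its generator
  set T : Subgroup.centralizer ({γ} : Set Γ) := ⟨τ, Subgroup.mem_centralizer_singleton_iff.2 hτ⟩ with hTdef
  set Φ : Subgroup (Subgroup.centralizer ({γ} : Set Γ)) := Subgroup.zpowers T with hΦdef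
  let τΦ : Φ := ⟨T, Subgroup.mem_zpowers T⟩
  have hΦsmul : ∀ (φ : Φ) (v : V), φ • v = act ((φ : Subgroup.centralizer ({γ} : Set Γ)) : Γ) v := fun _ _ => rfl
  have hτΦcoe : ∀ n : ℤ, (((τΦ ^ n : Φ) : Subgroup.centralizer ({γ} : Set Γ)) : Γ) = τ ^ n := fun n => by
    rw [SubgroupClass.coe_zpow, SubgroupClass.coe_zpow]
  have hgen : ∀ φ : Φ, ∃ n : ℤ, τΦ ^ n = φ := fun φ => by
    obtain ⟨n, hn⟩ := Subgroup.mem_zpowers_iff.1 φ.2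
    exact ⟨n, Subtype.ext (by rw [SubgroupClass.coe_zpow]; exact hn)⟩
  have hadj' : ∀ (φ : Φ) (a b : V), G.Adj (φ • a) (φ • b) ↔ G.Adj a b := fun φ a b => by
    rw [hΦsmul, hΦsmul]; exact (act _).map_rel_iff
  have hτΦ : ∀ (n : ℤ) (v : V), τΦ ^ n • v = act (τ ^ n) v := fun n v => by rw [hΦsmul, hτΦcoe]
  have hstep' : G.Adj v₀ (τΦ • v₀) := by
    have := hτΦ 1 v₀
    rw [zpow_one, zpow_one] at this
    rw [this]; exact hstep
  have hfree' : ∀ n : ℤ, τΦ ^ n • v₀ = v₀ → n = 0 := fun n hn => hfree n (by rw [← hτΦ]; exact hn)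
  -- `γ` as a permutation of `V`
  let γ' : V ≃ V := (act γ).toEquiv
  have hγ' : ∀ v : V, γ' v = act γ v := fun _ => rfl
  have hγadj : ∀ a b : V, G.Adj (γ' a) (γ' b) ↔ G.Adj a b := fun a b => (act γ).map_rel_iff
  have hcomm : ∀ (φ : Φ) (v : V), φ • γ' v = γ' (φ • v) := fun φ v => by
    have hc : ((φ : Subgroup.centralizer ({γ} : Set Γ)) : Γ) * γ = γ * ((φ : Subgroup.centralizer ({γ} : Set Γ)) : Γ) :=
      Subgroup.mem_centralizer_singleton_iff.1 (φ : Subgroup.centralizer ({γ} : Set Γ)).2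
    rw [hΦsmul, hΦsmul, hγ', hγ', ← hmul, hc, hmul]
  have hγ₀ : ∃ k : ℤ, γ' v₀ = τΦ ^ k • v₀ := by
    obtain ⟨k, hk⟩ := hγ
    exact ⟨k, by rw [hγ', hk, hτΦ]⟩
  /- the three dictionaries -/
  -- vertices
  have hKv' : ∀ g : Γ, g ∈ Kv ↔ g • v₀ = v₀ := fun g => by rw [hKv, hsmul]
  obtain ⟨hVeq, hVfin⟩ := natCard_quotient_orbitRel_fixedBy_eq_of_dictionary v₀ Kv hKv' γ τ hτ
  have hSV : {x : V | (∃ g : Γ, g • v₀ = x) ∧ γ • x = x} = {v : V | γ' v = v} := Set.ext fun v =>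
    ⟨fun h => h.2, fun h => ⟨hV v, h⟩⟩
  -- geometric edges (two-element sets)
  have hpair : ∀ g : Γ, g • ({v₀, v₁} : Set V) = {act g v₀, act g v₁} := fun g => by
    rw [Set.smul_set_insert, Set.smul_set_singleton]; rfl
  have hKe' : ∀ g : Γ, g ∈ Ke ↔ g • ({v₀, v₁} : Set V) = {v₀, v₁} := fun g => by
    rw [hKe, hpair, Set.pair_eq_pair_iff, Sym2.eq_iff]
  obtain ⟨hEeq, hEfin⟩ := natCard_quotient_orbitRel_fixedBy_eq_of_dictionary ({v₀, v₁} : Set V) Ke hKe' γ τ hτ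
  have hSE : {x : Set V | (∃ g : Γ, g • ({v₀, v₁} : Set V) = x) ∧ γ • x = x} =
      {s : Set V | (∃ a b : V, G.Adj a b ∧ s = {a, b}) ∧ γ' '' s = s} := Set.ext fun s => by
    constructor
    · rintro ⟨⟨g, rfl⟩, hfix⟩
      exact ⟨⟨act g v₀, act g v₁, (act g).map_rel_iff.2 h01, hpair g⟩, hfix⟩
    · rintro ⟨⟨a, b, hab, rfl⟩, hfix⟩
      obtain ⟨g, hga, hgb⟩ := hD a b hab
      exact ⟨⟨g, by rw [hpair, hga, hgb]⟩, hfix⟩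
  -- darts
  have hKI' : ∀ g : Γ, g ∈ I ↔ g • ((v₀, v₁) : V × V) = (v₀, v₁) := fun g => by
    rw [hI, Prod.smul_mk, Prod.mk.injEq, hsmul, hsmul]
  obtain ⟨hIeq, hIfin⟩ := natCard_quotient_orbitRel_fixedBy_eq_of_dictionary ((v₀, v₁) : V × V) I hKI' γ τ hτ
  have hSI : {x : V × V | (∃ g : Γ, g • ((v₀, v₁) : V × V) = x) ∧ γ • x = x} =
      {d : V × V | G.Adj d.1 d.2 ∧ γ' d.1 = d.1 ∧ γ' d.2 = d.2} := Set.ext fun d => by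
    constructor
    · rintro ⟨⟨g, rfl⟩, hfix⟩
      rw [Prod.smul_mk, Prod.smul_mk, Prod.mk.injEq] at hfix
      exact ⟨(act g).map_rel_iff.2 h01, hfix.1, hfix.2⟩
    · rintro ⟨hab, ha, hb⟩
      obtain ⟨g, hga, hgb⟩ := hD d.1 d.2 hab
      exact ⟨⟨g, by rw [Prod.smul_mk, hsmul, hsmul, hga, hgb]⟩, Prod.ext ha hb⟩
  rw [hSV] at hVeq hVfin
  rw [hSE] at hEeq hEfin
  rw [hSI] at hIeq hIfin
  rw [hVeq, hEeq, hIeq]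
  exact natCard_quotient_fixed_vertices_add_edges_eq_darts_of_exists hT hadj' τΦ hgen v₀ hstep' hfree' γ' hγadj hcomm hγ₀ (hIfin.1 hfinI)

/-- **The same, for an action given on vertices** (`act g : V → V` with `act 1 = id`, `act (g h) = act g ∘ act h`, preserving adjacency — the shape of ★ `glVertexAct` and
of B-p08 (g28)'s `rhoVertexAct` for `U(Φ₂)(E_w)` on the tree of `SL₂(F_v)`): the hom `Γ →* (G ≃g G)` is assembled here exactly as in ★
`natCard_fixedBy_add_eq_natCard_fixedBy_add_one_of_vertexAction`. [cite: Kottwitz1988, §2 Theorem 2] [cite: Serre1980Trees, I.6.1; II.1.1–1.3] -/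
theorem natCard_quotient_fixedBy_add_eq_natCard_quotient_fixedBy_of_vertexAction (hT : G.IsTree) (act : Γ → V → V)
    (act_one : ∀ v : V, act 1 v = v) (act_mul : ∀ (g h : Γ) (v : V), act (g * h) v = act g (act h v))
    (act_adj : ∀ (g : Γ) (a b : V), G.Adj (act g a) (act g b) ↔ G.Adj a b)
    {v₀ v₁ : V} (h01 : G.Adj v₀ v₁) (hV : ∀ v : V, ∃ g : Γ, act g v₀ = v)
    (hD : ∀ a b : V, G.Adj a b → ∃ g : Γ, act g v₀ = a ∧ act g v₁ = b)
    (Kv Ke I : Subgroup Γ) (hKv : ∀ g : Γ, g ∈ Kv ↔ act g v₀ = v₀)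
    (hKe : ∀ g : Γ, g ∈ Ke ↔ s(act g v₀, act g v₁) = s(v₀, v₁))
    (hI : ∀ g : Γ, g ∈ I ↔ act g v₀ = v₀ ∧ act g v₁ = v₁)
    (γ τ : Γ) (hτ : τ * γ = γ * τ) (hstep : G.Adj v₀ (act τ v₀)) (hfree : ∀ n : ℤ, act (τ ^ n) v₀ = v₀ → n = 0)
    (hγ : ∃ k : ℤ, act γ v₀ = act (τ ^ k) v₀)
    (hfinI : Finite (Quotient ((orbitRel (Subgroup.zpowers (⟨τ, Subgroup.mem_centralizer_singleton_iff.2 hτ⟩ : Subgroup.centralizer ({γ} : Set Γ))) (Γ ⧸ I)).comap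
        (Subtype.val : ↥(fixedBy (Γ ⧸ I) γ) → Γ ⧸ I)))) :
    Nat.card (Quotient ((orbitRel (Subgroup.zpowers (⟨τ, Subgroup.mem_centralizer_singleton_iff.2 hτ⟩ : Subgroup.centralizer ({γ} : Set Γ))) (Γ ⧸ Kv)).comap
        (Subtype.val : ↥(fixedBy (Γ ⧸ Kv) γ) → Γ ⧸ Kv))) +
        Nat.card (Quotient ((orbitRel (Subgroup.zpowers (⟨τ, Subgroup.mem_centralizer_singleton_iff.2 hτ⟩ : Subgroup.centralizer ({γ} : Set Γ))) (Γ ⧸ Ke)).comap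
        (Subtype.val : ↥(fixedBy (Γ ⧸ Ke) γ) → Γ ⧸ Ke))) =
      Nat.card (Quotient ((orbitRel (Subgroup.zpowers (⟨τ, Subgroup.mem_centralizer_singleton_iff.2 hτ⟩ : Subgroup.centralizer ({γ} : Set Γ))) (Γ ⧸ I)).comap
        (Subtype.val : ↥(fixedBy (Γ ⧸ I) γ) → Γ ⧸ I))) := by
  -- each `act g` is a graph automorphism with inverse `act g⁻¹`
  have hinv₁ : ∀ (g : Γ) (v : V), act g⁻¹ (act g v) = v := fun g v => by rw [← act_mul, inv_mul_cancel, act_one]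
  have hinv₂ : ∀ (g : Γ) (v : V), act g (act g⁻¹ v) = v := fun g v => by rw [← act_mul, mul_inv_cancel, act_one]
  let ι : Γ → (G ≃g G) := fun g =>
    { toFun := act g
      invFun := act g⁻¹
      left_inv := hinv₁ g
      right_inv := hinv₂ g
      map_rel_iff' := by intro a b; exact act_adj g a b }
  have hι : ∀ (g : Γ) (v : V), ι g v = act g v := fun _ _ => rfl
  let ιh : Γ →* (G ≃g G) :=
    { toFun := ι
      map_one' := RelIso.ext fun v => by rw [hι, act_one]; rfl
      map_mul' := fun a b => RelIso.ext fun v => by rw [RelIso.mul_apply, hι, hι, hι, act_mul] }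
  have hιh : ∀ (g : Γ) (v : V), ιh g v = act g v := fun _ _ => rfl
  exact natCard_quotient_fixedBy_add_eq_natCard_quotient_fixedBy_of_treeAction hT ιh h01 hV hD Kv Ke I hKv hKe hI γ τ hτ hstep hfree hγ hfinI

end Head

end Literature.Combinatorics.SimpleGraph.TreeAction
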